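import Summits.QuantumFields.BalabanUV.Beta.FP.CovarianceRowSum
import Literature.MathematicalPhysics.QuantumFieldTheory.Balaban1983to89.Beta.VectorTailsPt

/-!
# `BalabanUV.Beta.FP.CovarianceRowDiff` — road «FP» (binder row D1), lane IR-5′, **THE (T1′) SOCKET, FILE F5d (ALGEBRA): THE GRADIENT ROW-SUM LETTER OF THE
# HARD COVARIANCE FROM TWO GRADIENT LETTERS** — `Σ_j ‖𝒞(i+ê_μ) j − 𝒞 i j‖ ≤ g₁ + ab₁ + g₁·c_C·c_G` from the GRADIENT row-sum letter `g₁` of the VECTOR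
# propagator `G = Δ_a⁻¹` ((1.115)'s SECOND entry «|∇GJ| ≤ O(1)|J|», B5 = Bałaban, CMP 95 (1984) p. 36 — in the tree at `a = 1` on CUBIC tori, see F5e
# `CovarianceRowDiffTower`), the GRADIENT row-sum letter `ab₁` of the
# COMPOSITE free × coarse gauge factor `∂Δ⁻¹R·RΔ⁻¹∂ᴴ` (ours; kept COMPOSITE on purpose — the factored `(S_μ−1)·∂Δ⁻¹R` alone is a second difference of the massless
# scalar kernel and its row sums are NOT log-free), and the two row-sum letters `c_C`, `c_G` the (T0′) chain already supplies (`CoarseSandwichInverseRowSum`,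
# pv15 `B5G115RowSum`) — our bookkeeping: generic row-sum algebra + `CovarianceGaugeFactor.Cov_eq_free_gauge'` BY NAME; no estimate is proved here

HONEST DEPENDENCY (page 1, mandatory): continuum YM on T⁴ ⇐ BetaPertH ∧ nine spine estimates (0/9 proved); BetaPertH ⇐ (D1) ∧ (D4) ∧
CAP+tail; G-an2-4 gates asym, D1 and NE2/3/4.  HONEST FRAMING (cell contract, verbatim): «discharging `BetaPertH` makes Bałaban's UV
stability UNCONDITIONAL — a real constructive-QFT result; it is NOT the continuum limit and NOT the Clay problem.»  THIS MODULE is generic [folklore]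
row-sum algebra for finite matrices over `ℂ` (§1) and its reading on `Cov_eq_free_gauge'` (§2–§3): every analytic input is a HYPOTHESIS displayed in the
signature.  It cites nothing, mints no `Prop`, has no `def`, 0 sorry.  It is the census, in Lean, of what the (T1′) socket (F5a–F5c: `PerfectFFBlockRowDiffTorus`,
`PerfectFFBlockRowDiff`, `GaugeTermRoadLegsCol`) still owes: its displayed tower letter `hC1` ⟸ `g₁ ≍ N⁻¹` (in the tree on cubic tori, F5e) ∧ `ab₁ ≍ N⁻¹` on the
tower tori (NOT in the tree).  NOT (T1′), NOT hslice, NOT (ASYMP), NOT D1, NOT BetaPertH, NOT continuum, NOT Clay.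

ABSOLUTE RULE (cell charter, verbatim): «No internally-minted statement may enter as a cited fact. Every hypothesis is either kernel-proved in this
package or a verbatim quotation of a PUBLISHED theorem with page reference. The manuscript(s) under audit are NOT citable for their own disputed
steps — they are the thing under adjudication; programme-internal (2001/route/tribunal) claims are never citable.»

CONTENT.  §1 `shift_mul_decomp` (`(T−1)·X = (T−1)G − (T−1)(AB) − ((T−1)G)·C·G` for `X = G − AB − GCG`, ANY `T`), **`rowSum_shift_le_of_decomp`**
(`Σ_j ‖((T−1)X) i j‖ ≤ g₁ + ab₁ + g₁·c_C·c_G`); §2 **`rowSum_shift_Cov_le`** (`T = shiftM (fine n M) μ`, `X = 𝒞`, any `a > 0`); §3 **`sum_norm_Cov_rowDiff_le`**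
(the ENTRY form `Σ_j ‖𝒞(i.1+ê_μ, i.2) j − 𝒞 i j‖ ≤ …` — the shape F5a–F5c display, via `VectorTailsPt.shiftM_mul_apply`).
Unit `b2b-balaban-beta-d1-formalise-leaf-05` (gen 22), 2026-08-21; `LEAVES-FP.md` row «(T1′) SOCKET F5d».  «not in print; our bookkeeping».
-/

noncomputable section

open scoped BigOperators Matrix ComplexConjugate

namespace Summit.QuantumFields.BalabanUV.Beta.FP.CovarianceRowDiff

open Literature.MathematicalPhysics.QuantumFieldTheory.Balaban1983to89
open Literature.MathematicalPhysics.QuantumFieldTheory.Balaban1983to89.B5Prop11Plancherel (Tor fine calG shiftM unitVec)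
open Literature.MathematicalPhysics.QuantumFieldTheory.Balaban1983to89.B5Action121 (GradOp)
open Literature.MathematicalPhysics.QuantumFieldTheory.Balaban1983to89.B5Block118 (QvOp)
open Literature.MathematicalPhysics.QuantumFieldTheory.Balaban1983to89.B5LaplaceInverse (LapSinv)
open Literature.MathematicalPhysics.QuantumFieldTheory.Balaban1983to89.B5DeltaA169 (QvAdj)
open Literature.MathematicalPhysics.QuantumFieldTheory.Balaban1983to89.B5Identities197Torus (RT)
open Literature.MathematicalPhysics.QuantumFieldTheory.Balaban1983to89.Beta.FluctuationProjection (Cov QGQ)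
open Literature.MathematicalPhysics.QuantumFieldTheory.Balaban1983to89.Beta.VectorTailsPt (shiftM_mul_apply)
open Summit.QuantumFields.BalabanUV.Beta.FP.CovarianceGaugeFactor (Cov_eq_free_gauge')
open Summit.QuantumFields.BalabanUV.Beta.FP.CovarianceRowSum (rowSum_mul_le rowSum_sub_le rowSum_nonneg_of_le)

/-! ## §1 Row-sum algebra for `(T − 1)·(G − A·B − G·C·G)` -/

section RowSum

variable {ι κ : Type*} [Fintype ι] [Fintype κ] [DecidableEq ι]

/-- [folklore] `(T − 1)·X = (T − 1)·G − (T − 1)·(A·B) − ((T − 1)·G)·C·G` for `X = G − A·B − G·C·G` (ring algebra; the gauge factor is kept COMPOSITE). -/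
theorem shift_mul_decomp {T G C X : Matrix ι ι ℂ} {A : Matrix ι κ ℂ} {B : Matrix κ ι ℂ} (hX : X = G - A * B - G * C * G) :
    (T - 1) * X = (T - 1) * G - (T - 1) * (A * B) - (T - 1) * G * C * G := by
  rw [hX, Matrix.mul_sub, Matrix.mul_sub, Matrix.mul_assoc (T - 1) G C, Matrix.mul_assoc (T - 1) (G * C) G, Matrix.mul_assoc G C G]

/-- [folklore] **ROW SUMS OF `(T − 1)·X` FOR `X = G − A·B − G·C·G`**: `Σ_j ‖((T−1)X) i j‖ ≤ g₁ + ab₁ + g₁·c_C·c_G` from the row-sum letters of `(T−1)G` (`g₁`),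
of the COMPOSITE `(T−1)(AB)` (`ab₁`), of `C` and of `G`. -/
theorem rowSum_shift_le_of_decomp [Nonempty ι] {T G C X : Matrix ι ι ℂ} {A : Matrix ι κ ℂ} {B : Matrix κ ι ℂ}
    {g₁ ab₁ cC cG : ℝ} (hX : X = G - A * B - G * C * G)
    (hG1 : ∀ i, ∑ j, ‖((T - 1) * G) i j‖ ≤ g₁) (hAB1 : ∀ i, ∑ j, ‖((T - 1) * (A * B) : Matrix ι ι ℂ) i j‖ ≤ ab₁)
    (hC : ∀ i, ∑ j, ‖C i j‖ ≤ cC) (hG : ∀ i, ∑ j, ‖G i j‖ ≤ cG) (i : ι) :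
    ∑ j, ‖((T - 1) * X) i j‖ ≤ g₁ + ab₁ + g₁ * cC * cG := by
  rw [shift_mul_decomp hX]
  have hGC : ∀ i, ∑ j, ‖((T - 1) * G * C) i j‖ ≤ g₁ * cC := rowSum_mul_le hG1 hC
  have hGCG := rowSum_mul_le hGC hG
  have h1 := rowSum_sub_le hG1 hAB1
  have h2 := rowSum_sub_le h1 hGCG i
  linarith

end RowSum

/-! ## §2 The hard covariance: `T = S_μ`, `X = 𝒞` -/

section Cov

variable {d : ℕ} (n : ℕ) [NeZero n] (hn : 1 ≤ n) (M : Fin d → ℕ) [hM : ∀ μ, NeZero (M μ)] (a : ℝ) (ha : 0 < a)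

/-- [our bookkeeping] **THE GRADIENT ROW-SUM LETTER OF `𝒞` FROM TWO GRADIENT LETTERS** (`CovarianceGaugeFactor.Cov_eq_free_gauge'`): with `S = shiftM (fine n M) μ`,
`G = calG`, `AB = (∂·Δ⁻¹·R)·(R·Δ⁻¹·∂ᴴ)`, `C = Q*·(QGQ*)⁻¹·Q`:
`Σ_j ‖((S − 1)·𝒞) i j‖ ≤ g₁ + ab₁ + g₁·c_C·c_G` for every row `i`, from `hG1` ((1.115)'s second entry for the VECTOR `G`, displayed), `hAB1` (the composite gauge
factor's gradient letter, displayed), `hC`, `hG` (the (T0′) chain's letters). -/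
theorem rowSum_shift_Cov_le (μ : Fin d) {g₁ ab₁ cC cG : ℝ}
    (hG1 : ∀ i, ∑ j, ‖((shiftM (fine n M) μ - 1) * calG n hn M a ha) i j‖ ≤ g₁)
    (hAB1 : ∀ i, ∑ j, ‖((shiftM (fine n M) μ - 1) *
      ((GradOp (fine n M) (n : ℂ) * LapSinv (fine n M) (n : ℂ) * RT n M) * (RT n M * LapSinv (fine n M) (n : ℂ) * (GradOp (fine n M) (n : ℂ))ᴴ))
        : Matrix (Tor (fine n M) × Fin d) (Tor (fine n M) × Fin d) ℂ) i j‖ ≤ ab₁)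
    (hC : ∀ i, ∑ j, ‖(QvAdj n M * (QGQ n hn M a ha)⁻¹ * QvOp n M) i j‖ ≤ cC)
    (hG : ∀ i, ∑ j, ‖calG n hn M a ha i j‖ ≤ cG)
    (i : Tor (fine n M) × Fin d) :
    ∑ j, ‖((shiftM (fine n M) μ - 1) * Cov n hn M a ha) i j‖ ≤ g₁ + ab₁ + g₁ * cC * cG := by
  haveI : Nonempty (Tor (fine n M) × Fin d) := ⟨i⟩
  exact rowSum_shift_le_of_decomp (Cov_eq_free_gauge' n hn M a ha) hG1 hAB1 hC hG i

/-! ## §3 The entry form the (T1′) socket displays -/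

/-- [folklore] the entries of `(S_μ − 1)·X`: `((S_μ − 1)·X) i j = X (i.1 + ê_μ, i.2) j − X i j`. -/
theorem shiftM_sub_one_mul_apply (μ : Fin d) (X : Matrix (Tor (fine n M) × Fin d) (Tor (fine n M) × Fin d) ℂ)
    (i j : Tor (fine n M) × Fin d) :
    ((shiftM (fine n M) μ - 1) * X) i j = X (i.1 + unitVec (fine n M) μ, i.2) j - X i j := by
  rw [Matrix.sub_mul, Matrix.one_mul, Matrix.sub_apply, shiftM_mul_apply]

/-- [our bookkeeping] **THE DISPLAYED LETTER OF F5a–F5c, ENTRY FORM**: `Σ_j ‖𝒞(i.1+ê_μ, i.2) j − 𝒞 i j‖ ≤ g₁ + ab₁ + g₁·c_C·c_G` for every row `i` and direction `μ`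
(read at `a = 1` on the tower tori with `g₁`, `ab₁ ≍ N⁻¹`, this is the `hC1` of `PerfectFFBlockRowDiff` ∕ `GaugeTermRoadLegsCol`). -/
theorem sum_norm_Cov_rowDiff_le (μ : Fin d) {g₁ ab₁ cC cG : ℝ}
    (hG1 : ∀ i, ∑ j, ‖((shiftM (fine n M) μ - 1) * calG n hn M a ha) i j‖ ≤ g₁)
    (hAB1 : ∀ i, ∑ j, ‖((shiftM (fine n M) μ - 1) *
      ((GradOp (fine n M) (n : ℂ) * LapSinv (fine n M) (n : ℂ) * RT n M) * (RT n M * LapSinv (fine n M) (n : ℂ) * (GradOp (fine n M) (n : ℂ))ᴴ))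
        : Matrix (Tor (fine n M) × Fin d) (Tor (fine n M) × Fin d) ℂ) i j‖ ≤ ab₁)
    (hC : ∀ i, ∑ j, ‖(QvAdj n M * (QGQ n hn M a ha)⁻¹ * QvOp n M) i j‖ ≤ cC)
    (hG : ∀ i, ∑ j, ‖calG n hn M a ha i j‖ ≤ cG)
    (i : Tor (fine n M) × Fin d) :
    ∑ j, ‖Cov n hn M a ha (i.1 + unitVec (fine n M) μ, i.2) j - Cov n hn M a ha i j‖ ≤ g₁ + ab₁ + g₁ * cC * cG := by
  have h := rowSum_shift_Cov_le n hn M a ha μ hG1 hAB1 hC hG i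
  simp_rw [shiftM_sub_one_mul_apply] at h
  exact h

end Cov

end Summit.QuantumFields.BalabanUV.Beta.FP.CovarianceRowDiff

end
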